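import Literature.NumberTheory.LFunctions.AriasDeReynaCoefficientBound
import Mathlib.MeasureTheory.Integral.Prod
import Mathlib.Analysis.SpecialFunctions.Pow.Continuity
import HarnessLib

/-!
# Arias de Reyna's bound for the remainder of the Riemann–Siegel expansion (Math. Comp. 80 (2011), Thm. 4.2)

Topic `Literature/NumberTheory/LFunctions` (namespace `Literature.NumberTheory.LFunctions.AriasDeReyna`).
Fifth file of the proof of the tree's named fact `Literature.NumberTheory.LFunctions.arias_lehmer_rs_bound`.
`AriasDeReynaExpansion.lean` proved Thm. 3.1 with the remainder written as the integral
`c ∫ e^{−4πu²}(−w)^{K+1} ℛ_K(u) du/(2i sin πx)` over the saddle-point line, where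
`ℛ_K(u) = (2πi)^{−1}∫_L G_{σ,4πu²}(ζ) dζ/(ζ^{K+1}(ζ + w))` is the Cauchy remainder over Arias de Reyna's line
`L` (`AriasDeReynaTaylorLine.lean`). This file carries out the proof of Thm. 4.2 (eq. (4.9) and the two
chains of inequalities after it):

* `remIntegrand`, `remMajorant` — the integrand and its two-variable majorant
  `Φ(u,y) = |u|^K e^{−4πu²}|G_{σ,4πu²}(ζ(y))|/|ζ(y)|^{K+1}`; `norm_remIntegrand_le` (Step 1:
  `|w| = √2|u|/a`, `|2 sin πx| ≥ 2π|u|`, `norm_lineRem_le`);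
* `integral_remMajorant` (Step 2: the Gaussian moment `∫|u|^K e^{−4π(1+V)u²} du = Γ((K+1)/2)/(4π(1+V))^{(K+1)/2}`);
* `wL y = |ζ(y)|²(1 + V(ζ(y)))` — the weight `W` of the source — and `pointwise_le_eConst_div` (Step 4: the
  `L¹–L^∞` interpolation `∫ W^{−(K+1)/2} ≤ (max 1/W)^{(K−1)/2} ∫ 1/W`, with `|1−ζ|^{−σ} ≤ (2√2)^σ` for `σ ≥ 0`
  and `|1−ζ|^{−σ} ≤ 2√2 (|1−ζ|²/W)^{m/2} W^{m/2}`, `m = ⌈−σ⌉`, for `σ < 0`);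
* `norm_integral_remIntegrand_le` (Steps 3+5: Tonelli for the non-negative majorant, as `∫⁻`);
* **`norm_cConst_mul_integral_remIntegrand_le`** — Thm. 4.2: `|remainder| ≤ c₁(σ)Γ((K+1)/2)(1.1/a)^{K+1}`,
  `c₁ = 2^{3σ/2}/7` (`σ ≥ 0`), `(9/10)^{⌈−σ⌉}/2` (`σ < 0`), and **`norm_rsLineIntegral_sub_main_le`** —
  Thm. 3.1 + Thm. 4.2 for non-integer `a`;

all three FROM the numerical constants of the line `L`, taken here as hypotheses in the form
`W ≥ 0.1316` (source: `max 1/W = 7.489341`; what is needed is `max 1/W < 2π·1.21 = 7.6027`),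
`∫_ℝ dy/W ≤ 15` (source: `∫_L|dζ|/W = 9.577048`, i.e. `13.544` in `dy = √2|dζ|`; needed: `≤ 15.16`) and
`|1 − ζ|² ≤ 6.15 W` (source: `5.78453`; needed: `< 0.81·2π·1.21 = 6.158`). They are proved in
`AriasDeReynaLineNumerics.lean`; nothing here is a named fact.

## References

* J. Arias de Reyna, *High precision computation of Riemann's zeta function by the Riemann–Siegel
  formula, I*, Math. Comp. 80 (2011), 995–1009: Thm. 4.2, eqs. (4.7)–(4.9), pp. 1001–1003. [AriasDeReyna2011]
-/

noncomputable section

open Complex MeasureTheory Set Filter Metric Real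
open scoped Topology ENNReal
open Literature.NumberTheory.LFunctions.SiegelIntegral Literature.NumberTheory.LFunctions.Gabcke

namespace Literature.NumberTheory.LFunctions

namespace AriasDeReyna

variable {σ a : ℝ} {K : ℕ}

/-! ## The weight `W(y) = |ζ(y)|² (1 + V(ζ(y)))` on the line `L` -/

/-- The weight `W(y) = |ζ|² (1 + V(ζ))` at the point `ζ = ζ(y) = ½ + (1+i)y/2` of the line `L`
(`V = Re f`); Thm. 4.2 needs `min_L W`, `∫_L |dζ|/W` and `max_L |1 − ζ|²/W`.
[cite: AriasDeReyna2011, proof of Thm. 4.2, eq. (4.9) and the three displayed constants] -/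
def wL (y : ℝ) : ℝ := ‖lineL y‖ ^ 2 * (1 + (fKer (lineL y)).re)

/-- Real points of the chart lie on `L`, off the cut. [cite: AriasDeReyna2011, proof of Thm. 4.2] -/
lemma lineL_ofReal_mem_cutPlane (y : ℝ) : lineL y ∈ cutPlane :=
  lineL_mem_cutPlane (by simp only [Complex.ofReal_im]; norm_num)

/-- `y ↦ f(ζ(y))` is continuous along `L`. [cite: AriasDeReyna2011, proof of Thm. 4.2] -/
lemma continuous_fKer_lineL : Continuous fun y : ℝ ↦ fKer (lineL y) :=
  continuousOn_fKer.comp_continuous (continuous_lineL.comp continuous_ofReal) lineL_ofReal_mem_cutPlane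

/-- `W` is continuous. [cite: AriasDeReyna2011, proof of Thm. 4.2] -/
lemma continuous_wL : Continuous wL := by
  unfold wL
  exact ((continuous_norm.comp (continuous_lineL.comp continuous_ofReal)).pow 2).mul
    (continuous_const.add (Complex.continuous_re.comp continuous_fKer_lineL))

/-- A positive lower bound for `W` makes `1 + V > 0` along `L` (the source: "this is always positive").
[cite: AriasDeReyna2011, proof of Thm. 4.2] -/
lemma one_add_re_fKer_pos {m₀ : ℝ} (hm₀ : 0 < m₀) (hm : ∀ y, m₀ ≤ wL y) (y : ℝ) :
    0 < 1 + (fKer (lineL y)).re := by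
  have h := hm y
  rw [wL] at h
  rcases lt_or_ge 0 (1 + (fKer (lineL y)).re) with hpos | hneg
  · exact hpos
  · have : ‖lineL ↑y‖ ^ 2 * (1 + (fKer (lineL ↑y)).re) ≤ 0 :=
      mul_nonpos_of_nonneg_of_nonpos (sq_nonneg _) hneg
    linarith

/-- `W > 0` from the lower bound. [cite: AriasDeReyna2011, proof of Thm. 4.2] -/
lemma wL_pos {m₀ : ℝ} (hm₀ : 0 < m₀) (hm : ∀ y, m₀ ≤ wL y) (y : ℝ) : 0 < wL y :=
  lt_of_lt_of_le hm₀ (hm y)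

/-! ## The remainder integrand and its majorant -/

/-- The remainder integrand of Thm. 3.1 on the saddle line:
`e^{−4πu²} (−w)^{K+1} ℛ_K(u) / (2i sin πx)`, `w = (1+i)u/a`, `ℛ_K(u) = lineRem σ (4πu²) K (−w)`.
[cite: AriasDeReyna2011, eq. (3.10) and proof of Thm. 4.2] -/
def remIntegrand (σ a : ℝ) (K : ℕ) (u : ℝ) : ℂ :=
  (Real.exp (-4 * π * u ^ 2) : ℂ) * ((-gW a u) ^ (K + 1) * lineRem σ (4 * π * u ^ 2) K (-gW a u)) /
    (2 * I * Complex.sin (π * line a u))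

/-- The two-variable majorant `Φ(u, y) = |u|^K e^{−4πu²} |G_{σ,4πu²}(ζ(y))| / |ζ(y)|^{K+1}` of (4.9).
[cite: AriasDeReyna2011, proof of Thm. 4.2, eq. (4.9)] -/
def remMajorant (σ : ℝ) (K : ℕ) (u y : ℝ) : ℝ :=
  |u| ^ K * Real.exp (-4 * π * u ^ 2) * (‖gKer σ (4 * π * u ^ 2) (lineL y)‖ / ‖lineL y‖ ^ (K + 1))

/-- `Φ ≥ 0`. [cite: AriasDeReyna2011, proof of Thm. 4.2] -/
lemma remMajorant_nonneg (σ : ℝ) (K : ℕ) (u y : ℝ) : 0 ≤ remMajorant σ K u y := by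
  unfold remMajorant; positivity

/-- **Step 1 (pointwise in `u`)**: `|integrand(u)| ≤ ((√2/a)^{K+1}/(2π²)) ∫ Φ(u, y) dy`
(`|w| = √2|u|/a`, `|2 sin πx| ≥ 2π|u|`, and the line-remainder bound `norm_lineRem_le`).
[cite: AriasDeReyna2011, proof of Thm. 4.2, first line of eq. (4.9)] -/
theorem norm_remIntegrand_le (ha : 0 < a) (hK1 : 1 ≤ K) (hKσ : 1 ≤ (K : ℝ) + σ) (u : ℝ) :
    ‖remIntegrand σ a K u‖ ≤ (Real.sqrt 2 / a) ^ (K + 1) / (2 * π ^ 2) * ∫ y, remMajorant σ K u y := by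
  have hK0 : K ≠ 0 := by omega
  by_cases hu : u = 0
  · subst hu
    have h0 : remIntegrand σ a K 0 = 0 := by
      simp [remIntegrand, gW]
    have h1 : ∀ y, remMajorant σ K 0 y = 0 := fun y ↦ by simp [remMajorant, zero_pow hK0]
    rw [h0, norm_zero]
    simp_rw [h1]
    rw [integral_zero, mul_zero]
  have hlam : 0 ≤ 4 * π * u ^ 2 := by positivity
  have hw : (-gW a u).re = (-gW a u).im := neg_gW_re_eq_im a u
  have hR := norm_lineRem_le hlam hK1 hKσ hw
  -- `|sin π(a + u(1+i))| ≥ sinh(π|u|) ≥ π|u|` (the source's `|x/cosh(π(ip+εx)/2)| ≤ 4/(π√2)`; this is the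
  -- tree's `SiegelIntegral.pi_mul_abs_le_norm_sin` of `LehmanCriticalLineBoundProofs.lean`, re-derived
  -- here to keep the imports light)
  have hsin : π * |u| ≤ ‖Complex.sin (π * line a u)‖ := by
    have hsq : ‖Complex.sin (π * line a u)‖ ^ 2 = Real.sin (π * (a + u)) ^ 2 + Real.sinh (π * u) ^ 2 := by
      rw [show (π : ℂ) * line a u = ((π * (a + u) : ℝ) : ℂ) + ((π * u : ℝ) : ℂ) * I by
        rw [line_eq]; push_cast; ring]
      exact sq_norm_sin_ofReal_add_mul_I _ _
    have hx : 0 ≤ π * |u| := by positivity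
    have h3 : π * |u| ≤ Real.sinh (π * |u|) := Real.self_le_sinh_iff.2 hx
    have h4 : Real.sinh (π * |u|) ^ 2 = Real.sinh (π * u) ^ 2 := by
      rcases abs_choice u with h | h
      · rw [h]
      · rw [h, mul_neg, Real.sinh_neg, neg_sq]
    have h5 : (π * |u|) ^ 2 ≤ ‖Complex.sin (π * line a u)‖ ^ 2 := by
      calc (π * |u|) ^ 2 ≤ Real.sinh (π * |u|) ^ 2 := pow_le_pow_left₀ hx h3 2
        _ = Real.sinh (π * u) ^ 2 := h4
        _ ≤ ‖Complex.sin (π * line a u)‖ ^ 2 := by rw [hsq]; nlinarith [sq_nonneg (Real.sin (π * (a + u)))]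
    exact (pow_le_pow_iff_left₀ hx (norm_nonneg _) two_ne_zero).1 h5
  have hupos : 0 < |u| := abs_pos.2 hu
  have hsin_pos : 0 < ‖Complex.sin (π * line a u)‖ := lt_of_lt_of_le (by positivity) hsin
  set J : ℝ := ∫ y : ℝ, ‖gKer σ (4 * π * u ^ 2) (lineL y)‖ / ‖lineL y‖ ^ (K + 1) with hJ
  have hJ0 : 0 ≤ J := integral_nonneg fun y ↦ by positivity
  have h2I : ‖(2 : ℂ) * I‖ = 2 := by simp
  have hnorm : ‖remIntegrand σ a K u‖ = Real.exp (-4 * π * u ^ 2) *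
      ((Real.sqrt 2 * |u| / a) ^ (K + 1) * ‖lineRem σ (4 * π * u ^ 2) K (-gW a u)‖) /
        (2 * ‖Complex.sin (π * line a u)‖) := by
    rw [remIntegrand, norm_div, norm_mul, norm_mul, norm_mul, norm_pow, norm_neg, norm_gW ha, h2I,
      Complex.norm_real, Real.norm_eq_abs, abs_of_pos (Real.exp_pos _)]
  rw [hnorm]
  have hstep : Real.exp (-4 * π * u ^ 2) *
      ((Real.sqrt 2 * |u| / a) ^ (K + 1) * ‖lineRem σ (4 * π * u ^ 2) K (-gW a u)‖) /
        (2 * ‖Complex.sin (π * line a u)‖) ≤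
      Real.exp (-4 * π * u ^ 2) * ((Real.sqrt 2 * |u| / a) ^ (K + 1) * (1 / π * J)) / (2 * (π * |u|)) := by
    refine div_le_div₀ (by positivity) ?_ (by positivity) (by linarith)
    exact mul_le_mul_of_nonneg_left (mul_le_mul_of_nonneg_left hR (by positivity)) (Real.exp_pos _).le
  refine hstep.trans (le_of_eq ?_)
  -- algebra: `(√2|u|/a)^{K+1}/|u| = (√2/a)^{K+1} |u|^K`
  have hpow : (Real.sqrt 2 * |u| / a) ^ (K + 1) = (Real.sqrt 2 / a) ^ (K + 1) * (|u| ^ K * |u|) := by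
    rw [← pow_succ, show Real.sqrt 2 * |u| / a = Real.sqrt 2 / a * |u| by ring, mul_pow]
  have hRHS : ∫ y, remMajorant σ K u y = |u| ^ K * Real.exp (-4 * π * u ^ 2) * J := by
    rw [hJ, ← integral_const_mul]
    rfl
  rw [hRHS, hpow]
  field_simp

/-! ## Step 2: the Gaussian integral in `u` for fixed `y` -/

/-- `c^{−(K+1)/2} = 1/(√c)^{K+1}` for `c ≥ 0`. [folklore] -/
private lemma rpow_neg_half_eq {c : ℝ} (hc : 0 ≤ c) (K : ℕ) :
    c ^ (-(((K : ℝ) + 1) / 2)) = ((Real.sqrt c) ^ (K + 1))⁻¹ := by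
  rw [Real.rpow_neg hc, Real.sqrt_eq_rpow, ← Real.rpow_natCast, ← Real.rpow_mul hc]
  congr 2
  push_cast
  ring

/-- **Step 2**: for fixed `y` with `1 + V(ζ(y)) > 0`,
`∫ Φ(u,y) du = |1 − ζ|^{−σ} Γ((K+1)/2) / (|ζ| √(4π(1+V)))^{K+1}` (`∫ |u|^K e^{−cu²} du = c^{−(K+1)/2}Γ((K+1)/2)`).
[cite: AriasDeReyna2011, proof of Thm. 4.2, eq. (4.9) (the factor `Γ((K+1)/2)/(1+V)^{(K+1)/2}`)] -/
theorem integral_remMajorant {y : ℝ} (hpos : 0 < 1 + (fKer (lineL y)).re) (σ : ℝ) (K : ℕ) :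
    ∫ u, remMajorant σ K u y = ‖1 - lineL y‖ ^ (-σ) * Real.Gamma (((K : ℝ) + 1) / 2) /
      (‖lineL y‖ * Real.sqrt (4 * π * (1 + (fKer (lineL y)).re))) ^ (K + 1) := by
  have hζ := lineL_ofReal_mem_cutPlane y
  set c : ℝ := 4 * π * (1 + (fKer (lineL y)).re) with hc
  have hc0 : 0 < c := by positivity
  have hpt : ∀ u : ℝ, remMajorant σ K u y =
      ‖1 - lineL y‖ ^ (-σ) / ‖lineL y‖ ^ (K + 1) * (|u| ^ (K + 1 - 1) * Real.exp (-c * u ^ 2)) := by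
    intro u
    rw [remMajorant, norm_gKer hζ, Nat.add_sub_cancel]
    have he : Real.exp (-c * u ^ 2) = Real.exp (-4 * π * u ^ 2) * Real.exp (-(4 * π * u ^ 2) * (fKer (lineL y)).re) := by
      rw [← Real.exp_add]; congr 1; rw [hc]; ring
    rw [he]
    field_simp
  simp_rw [hpt]
  rw [integral_const_mul, integral_abs_pow_mul_exp (by omega : 1 ≤ K + 1) hc0]
  have hcast : (((K + 1 : ℕ) : ℝ) / 2) = ((K : ℝ) + 1) / 2 := by push_cast; ring
  rw [hcast, rpow_neg_half_eq hc0.le, mul_pow]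
  have h1 : 0 < ‖lineL (y : ℂ)‖ ^ (K + 1) := pow_pos (norm_pos_iff.2 (lineL_ofReal_ne_zero y)) _
  have h2 : 0 < Real.sqrt c ^ (K + 1) := pow_pos (Real.sqrt_pos.2 hc0) _
  field_simp


/-! ## Step 3: continuity and integrability of the majorant -/

/-- Joint continuity of `(u, y) ↦ G_{σ,4πu²}(ζ(y))`. [cite: AriasDeReyna2011, proof of Thm. 4.2] -/
lemma continuous_gKer_lineL (σ : ℝ) :
    Continuous fun p : ℝ × ℝ ↦ gKer σ (4 * π * p.1 ^ 2) (lineL p.2) := by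
  unfold gKer
  have hD : ∀ p : ℝ × ℝ, lineL (p.2 : ℂ) ∈ cutPlane := fun p ↦ lineL_ofReal_mem_cutPlane p.2
  refine Continuous.cexp (Continuous.sub ?_ ?_)
  · refine continuous_const.mul ?_
    have hlog : ContinuousOn Complex.log slitPlane := fun z hz ↦ (continuousAt_clog hz).continuousWithinAt
    exact hlog.comp_continuous (f := fun p : ℝ × ℝ ↦ 1 - lineL (p.2 : ℂ))
      (continuous_const.sub ((continuous_lineL.comp continuous_ofReal).comp continuous_snd))
      fun p ↦ one_sub_mem_slitPlane (hD p)
  · exact (continuous_ofReal.comp (by fun_prop : Continuous fun p : ℝ × ℝ ↦ 4 * π * p.1 ^ 2)).mul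
      (continuous_fKer_lineL.comp continuous_snd)

/-- Joint continuity of the majorant `Φ(u, y)`. [cite: AriasDeReyna2011, proof of Thm. 4.2] -/
lemma continuous_remMajorant (σ : ℝ) (K : ℕ) :
    Continuous fun p : ℝ × ℝ ↦ remMajorant σ K p.1 p.2 := by
  unfold remMajorant
  have hl : Continuous fun p : ℝ × ℝ ↦ lineL (p.2 : ℂ) :=
    (continuous_lineL.comp continuous_ofReal).comp continuous_snd
  refine (((continuous_abs.comp continuous_fst).pow K).mul (by fun_prop)).mul ?_
  exact (continuous_norm.comp (continuous_gKer_lineL σ)).div ((continuous_norm.comp hl).pow _)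
    fun p ↦ pow_ne_zero _ (norm_ne_zero_iff.2 (lineL_ofReal_ne_zero p.2))

/-- For fixed `u`, `y ↦ Φ(u, y)` is integrable along `L`. [cite: AriasDeReyna2011, proof of Thm. 4.2] -/
lemma integrable_remMajorant_right (σ : ℝ) {K : ℕ} (hK1 : 1 ≤ K) (hKσ : 1 ≤ (K : ℝ) + σ) (u : ℝ) :
    Integrable fun y : ℝ ↦ remMajorant σ K u y := by
  have hlam : 0 ≤ 4 * π * u ^ 2 := by positivity
  have hiB := integrable_norm_gKer_lineL hlam hK1 hKσ (σ := σ)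
  have hiB' : Integrable (fun y : ℝ ↦ ‖gKer σ (4 * π * u ^ 2) (lineL y)‖ / ‖lineL y‖ ^ (K + 1)) :=
    hiB.re.congr (Eventually.of_forall fun y ↦ by simp only [RCLike.re_to_complex, Complex.ofReal_re])
  exact hiB'.const_mul _

/-- For fixed `y` with `1 + V(ζ(y)) > 0`, `u ↦ Φ(u, y)` is integrable. [cite: AriasDeReyna2011, proof of Thm. 4.2] -/
lemma integrable_remMajorant_left {y : ℝ} (hpos : 0 < 1 + (fKer (lineL y)).re) (σ : ℝ) (K : ℕ) :
    Integrable fun u : ℝ ↦ remMajorant σ K u y := by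
  have hζ := lineL_ofReal_mem_cutPlane y
  set c : ℝ := 4 * π * (1 + (fKer (lineL y)).re) with hc
  have hc0 : 0 < c := by positivity
  have h := (integrable_abs_pow_mul_exp K hc0).const_mul (‖1 - lineL y‖ ^ (-σ) / ‖lineL y‖ ^ (K + 1))
  refine h.congr (Eventually.of_forall fun u ↦ ?_)
  simp only
  rw [remMajorant, norm_gKer hζ]
  have he : Real.exp (-c * u ^ 2) =
      Real.exp (-4 * π * u ^ 2) * Real.exp (-(4 * π * u ^ 2) * (fKer (lineL y)).re) := by
    rw [← Real.exp_add]; congr 1; rw [hc]; ring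
  rw [he]
  field_simp

/-! ## Step 4: the pointwise comparison with `1/W` (the `L¹`–`L^∞` interpolation of the source) -/

/-- `|ζ| √(4π(1+V)) = √(4π W)`. [cite: AriasDeReyna2011, proof of Thm. 4.2] -/
lemma norm_mul_sqrt_eq (y : ℝ) (hpos : 0 < 1 + (fKer (lineL y)).re) :
    ‖lineL y‖ * Real.sqrt (4 * π * (1 + (fKer (lineL y)).re)) = Real.sqrt (4 * π * wL y) := by
  have h0 : 0 ≤ ‖lineL (y : ℂ)‖ * Real.sqrt (4 * π * (1 + (fKer (lineL y)).re)) := by positivity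
  rw [← Real.sqrt_sq h0, mul_pow, Real.sq_sqrt (by positivity), wL]
  congr 1
  ring

/-- `x^{−σ} = (x²)^{−σ/2}` for `x ≥ 0`. [folklore] -/
private lemma rpow_neg_eq_sq_rpow {x : ℝ} (hx : 0 ≤ x) (σ : ℝ) : x ^ (-σ) = (x ^ 2) ^ (-σ / 2) := by
  rw [show (x ^ 2 : ℝ) = x ^ (2 : ℝ) by rw [← Real.rpow_natCast]; norm_num, ← Real.rpow_mul hx]
  congr 1; ring

/-- `|1 − ζ|^{−σ} ≤ 2^{3σ/2}` on `L` for `σ ≥ 0` (`|1 − ζ| ≥ 1/(2√2)`). [cite: AriasDeReyna2011, proof of Thm. 4.2 ("`(2√2)^σ`")] -/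
lemma rpow_norm_one_sub_lineL_le (hσ : 0 ≤ σ) (y : ℝ) :
    ‖1 - lineL y‖ ^ (-σ) ≤ (2 : ℝ) ^ (3 * σ / 2) := by
  have h8 := normSq_one_sub_lineL_ge y
  rw [rpow_neg_eq_sq_rpow (norm_nonneg _)]
  calc (‖1 - lineL (y : ℂ)‖ ^ 2) ^ (-σ / 2) ≤ (1 / 8 : ℝ) ^ (-σ / 2) :=
        Real.rpow_le_rpow_of_nonpos (by norm_num) h8 (by linarith)
    _ = (2 : ℝ) ^ (3 * σ / 2) := by
        rw [show (-σ / 2 : ℝ) = -(σ / 2) by ring, one_div, Real.inv_rpow (by norm_num),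
          Real.rpow_neg (by norm_num), inv_inv, show (8 : ℝ) = 2 ^ (3 : ℝ) by norm_num,
          ← Real.rpow_mul (by norm_num)]
        congr 1; ring

/-- `|1 − ζ|^{−σ} ≤ 2√2 · |1 − ζ|^m` on `L` for `σ < 0`, `m = ⌈−σ⌉` (`0 ≤ σ + m < 1`, `|1 − ζ| ≥ 1/(2√2)`).
[cite: AriasDeReyna2011, proof of Thm. 4.2 ("`|1 − ζ|^{−σ−m} ≤ 2√2`")] -/
lemma rpow_norm_one_sub_lineL_le_of_neg (hσ : σ < 0) (y : ℝ) :
    ‖1 - lineL y‖ ^ (-σ) ≤ 2 * Real.sqrt 2 * ‖1 - lineL y‖ ^ ⌈-σ⌉₊ := by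
  set m : ℕ := ⌈-σ⌉₊ with hm
  have hm1 : -σ ≤ (m : ℝ) := Nat.le_ceil (-σ)
  have hm2 : (m : ℝ) < -σ + 1 := Nat.ceil_lt_add_one (by linarith)
  have hB0 : 0 < ‖1 - lineL (y : ℂ)‖ :=
    norm_pos_iff.2 (one_sub_ne_zero (lineL_ofReal_mem_cutPlane y))
  have h8 := normSq_one_sub_lineL_ge y
  have hsplit : ‖1 - lineL (y : ℂ)‖ ^ (-σ) = ‖1 - lineL (y : ℂ)‖ ^ (m : ℝ) * ‖1 - lineL (y : ℂ)‖ ^ (-σ - m) := by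
    rw [← Real.rpow_add hB0]; congr 1; ring
  rw [hsplit, Real.rpow_natCast, mul_comm]
  refine mul_le_mul_of_nonneg_right ?_ (pow_nonneg hB0.le _)
  -- `B^{−σ−m} = (B²)^{(−σ−m)/2} ≤ (1/8)^{(−σ−m)/2} = 8^{(σ+m)/2} ≤ 8^{1/2} = 2√2`
  have e1 : ‖1 - lineL (y : ℂ)‖ ^ (-σ - m) = (‖1 - lineL (y : ℂ)‖ ^ 2) ^ ((-σ - m) / 2) := by
    rw [show (-σ - (m : ℝ)) = -(σ + m) by ring, rpow_neg_eq_sq_rpow hB0.le]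
  rw [e1]
  calc (‖1 - lineL (y : ℂ)‖ ^ 2) ^ ((-σ - m) / 2) ≤ (1 / 8 : ℝ) ^ ((-σ - m) / 2) :=
        Real.rpow_le_rpow_of_nonpos (by norm_num) h8 (by linarith)
    _ = (8 : ℝ) ^ ((σ + m) / 2) := by
        rw [show ((σ + m) / 2 : ℝ) = -((-σ - m) / 2) by ring, Real.rpow_neg (by norm_num), one_div]
        exact Real.inv_rpow (by norm_num) _
    _ ≤ (8 : ℝ) ^ ((1 : ℝ) / 2) := Real.rpow_le_rpow_of_exponent_le (by norm_num) (by linarith)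
    _ = 2 * Real.sqrt 2 := by
        rw [← Real.sqrt_eq_rpow, show (8 : ℝ) = 2 ^ 2 * 2 by norm_num, Real.sqrt_mul (by norm_num),
          Real.sqrt_sq (by norm_num)]

/-- The function of `y` left after the `u`-integration, `ψ(y) = |1 − ζ|^{−σ} Γ((K+1)/2)/(√(4πW))^{K+1}`, and
the numerical constant `E(σ, K)` of the comparison `√2^{K+1} ψ ≤ E/W`. [cite: AriasDeReyna2011, proof of Thm. 4.2] -/
def eConst (σ : ℝ) (K : ℕ) : ℝ :=
  if 0 ≤ σ then (2 : ℝ) ^ (3 * σ / 2) * (1.1 : ℝ) ^ (K - 1) / (2 * π)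
  else 2 * Real.sqrt 2 * (0.9 : ℝ) ^ ⌈-σ⌉₊ * (1.1 : ℝ) ^ (K - 1) / (2 * π)

/-- `E(σ, K) ≥ 0`. [cite: AriasDeReyna2011, proof of Thm. 4.2] -/
lemma eConst_nonneg (σ : ℝ) (K : ℕ) : 0 ≤ eConst σ K := by
  unfold eConst; split_ifs <;> positivity

/-- `q = √2/√(4πW)` satisfies `q² = 1/(2πW)` and, when `W ≥ 0.1316`, `q ≤ 1.1` (this is where the constant
`b₁ = 1/1.1` of the source comes from: `√(7.49/2π) < 1.1`). [cite: AriasDeReyna2011, proof of Thm. 4.2] -/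
lemma q_sq_and_le {W : ℝ} (hW : (0.1316 : ℝ) ≤ W) :
    (Real.sqrt 2 / Real.sqrt (4 * π * W)) ^ 2 = 1 / (2 * π * W) ∧
      Real.sqrt 2 / Real.sqrt (4 * π * W) ≤ 1.1 := by
  have hπ := Real.pi_gt_d6
  have hW0 : 0 < W := by linarith
  have hsq : (Real.sqrt 2 / Real.sqrt (4 * π * W)) ^ 2 = 1 / (2 * π * W) := by
    rw [div_pow, Real.sq_sqrt (by norm_num), Real.sq_sqrt (by positivity)]
    field_simp
    ring
  refine ⟨hsq, ?_⟩
  have hq0 : 0 ≤ Real.sqrt 2 / Real.sqrt (4 * π * W) := by positivity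
  have h121 : 1 / (2 * π * W) ≤ (1.1 : ℝ) ^ 2 := by
    rw [div_le_iff₀ (by positivity)]
    nlinarith
  nlinarith [hsq, h121, hq0]

/-- **Step 4 (pointwise in `y`)**: with `W ≥ 0.1316` and `|1 − ζ|² ≤ 6.15 W`,
`√2^{K+1} · |1 − ζ|^{−σ}/(|ζ|√(4π(1+V)))^{K+1} ≤ E(σ,K)/W` for `K ≥ 1` and (`σ ≥ 0` or `K + σ ≥ 2`).
[cite: AriasDeReyna2011, proof of Thm. 4.2 (the two chains of inequalities after eq. (4.9))] -/
theorem pointwise_le_eConst_div {y : ℝ} (hK1 : 1 ≤ K) (hσK : 0 ≤ σ ∨ (2 : ℝ) ≤ K + σ)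
    (hW : (0.1316 : ℝ) ≤ wL y) (hA : ‖1 - lineL y‖ ^ 2 ≤ 6.15 * wL y)
    (hpos : 0 < 1 + (fKer (lineL y)).re) :
    Real.sqrt 2 ^ (K + 1) * (‖1 - lineL y‖ ^ (-σ) /
      (‖lineL y‖ * Real.sqrt (4 * π * (1 + (fKer (lineL y)).re))) ^ (K + 1)) ≤ eConst σ K / wL y := by
  have hπ := Real.pi_gt_d6
  set W := wL y with hWdef
  have hW0 : 0 < W := by linarith
  rw [norm_mul_sqrt_eq y hpos, ← hWdef]
  set q : ℝ := Real.sqrt 2 / Real.sqrt (4 * π * W) with hq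
  obtain ⟨hq2, hq11⟩ := q_sq_and_le hW
  have hq0 : 0 ≤ q := by positivity
  have hsW : 0 < Real.sqrt (4 * π * W) := Real.sqrt_pos.2 (by positivity)
  -- rewrite the left-hand side as `B^{−σ} q^{K+1}`
  have hlhs : Real.sqrt 2 ^ (K + 1) * (‖1 - lineL (y : ℂ)‖ ^ (-σ) / Real.sqrt (4 * π * W) ^ (K + 1))
      = ‖1 - lineL (y : ℂ)‖ ^ (-σ) * q ^ (K + 1) := by
    rw [hq, div_pow]; field_simp
  rw [hlhs]
  have hB0 : 0 ≤ ‖1 - lineL (y : ℂ)‖ ^ (-σ) := Real.rpow_nonneg (norm_nonneg _) _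
  obtain ⟨j, hj⟩ : ∃ j : ℕ, K = j + 1 := ⟨K - 1, by omega⟩
  rcases le_or_gt 0 σ with hσ | hσ
  · -- `σ ≥ 0`
    have hE : eConst σ K = (2 : ℝ) ^ (3 * σ / 2) * (1.1 : ℝ) ^ (K - 1) / (2 * π) := by simp [eConst, hσ]
    rw [hE]
    have hqK : q ^ (K + 1) ≤ (1.1 : ℝ) ^ (K - 1) * (1 / (2 * π * W)) := by
      rw [hj, Nat.add_sub_cancel, show j + 1 + 1 = j + 2 by ring, pow_add, hq2]
      exact mul_le_mul_of_nonneg_right (pow_le_pow_left₀ hq0 hq11 j) (by positivity)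
    calc ‖1 - lineL (y : ℂ)‖ ^ (-σ) * q ^ (K + 1)
        ≤ (2 : ℝ) ^ (3 * σ / 2) * ((1.1 : ℝ) ^ (K - 1) * (1 / (2 * π * W))) :=
          mul_le_mul (rpow_norm_one_sub_lineL_le hσ y) hqK (by positivity) (by positivity)
      _ = (2 : ℝ) ^ (3 * σ / 2) * (1.1 : ℝ) ^ (K - 1) / (2 * π) / W := by
          field_simp
  · -- `σ < 0`, `m = ⌈−σ⌉ ≥ 1`, `K ≥ m + 2`
    have hE : eConst σ K = 2 * Real.sqrt 2 * (0.9 : ℝ) ^ ⌈-σ⌉₊ * (1.1 : ℝ) ^ (K - 1) / (2 * π) := by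
      simp [eConst, not_le.2 hσ]
    rw [hE]
    set m : ℕ := ⌈-σ⌉₊ with hm
    have hm2 : (m : ℝ) < -σ + 1 := Nat.ceil_lt_add_one (by linarith)
    have hKσ : (2 : ℝ) ≤ K + σ := by
      rcases hσK with h | h
      · exact absurd h (not_le.2 hσ)
      · exact h
    have hKm : m + 2 ≤ K := by
      have : (m : ℝ) + 1 < K := by linarith
      exact_mod_cast this
    -- `B^{−σ} ≤ 2√2 B^m ≤ 2√2 (√(6.15 W))^m`
    have hB1 := rpow_norm_one_sub_lineL_le_of_neg hσ y
    rw [← hm] at hB1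
    have hBle : ‖1 - lineL (y : ℂ)‖ ≤ Real.sqrt (6.15 * W) := by
      rw [← Real.sqrt_sq (norm_nonneg (1 - lineL (y : ℂ)))]
      exact Real.sqrt_le_sqrt hA
    have hBm : ‖1 - lineL (y : ℂ)‖ ^ m ≤ Real.sqrt 6.15 ^ m * Real.sqrt W ^ m := by
      rw [← mul_pow, ← Real.sqrt_mul (by norm_num)]
      exact pow_le_pow_left₀ (norm_nonneg _) hBle m
    -- `q^{K+1} = q^2 q^{K-1-m} q^m`, `q √W = 1/√(2π)`... via squares: `(√6.15 √W q)^2 = 6.15/(2π) ≤ 0.99^2`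
    obtain ⟨i, hi⟩ : ∃ i : ℕ, K = m + 2 + i := ⟨K - (m + 2), by omega⟩
    have hK1' : K - 1 = m + (i + 1) := by omega
    have hprod_sq : (Real.sqrt 6.15 * Real.sqrt W * q) ^ 2 = 6.15 / (2 * π) := by
      rw [mul_pow, mul_pow, hq2, Real.sq_sqrt (by norm_num), Real.sq_sqrt hW0.le]
      field_simp
    have hprod0 : 0 ≤ Real.sqrt 6.15 * Real.sqrt W * q := by positivity
    have hprod : Real.sqrt 6.15 * Real.sqrt W * q ≤ 0.99 := by
      have h99 : (6.15 : ℝ) / (2 * π) ≤ 0.99 ^ 2 := by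
        rw [div_le_iff₀ (by positivity)]; nlinarith
      nlinarith [hprod_sq, h99, hprod0]
    have hchain : 2 * Real.sqrt 2 * ‖1 - lineL (y : ℂ)‖ ^ m * q ^ (K + 1) ≤
        2 * Real.sqrt 2 * ((0.99 : ℝ) ^ m * ((1.1 : ℝ) ^ (i + 1) * (1 / (2 * π * W)))) := by
      rw [mul_assoc (2 * Real.sqrt 2)]
      refine mul_le_mul_of_nonneg_left ?_ (by positivity : (0 : ℝ) ≤ 2 * Real.sqrt 2)
      have e : ‖1 - lineL (y : ℂ)‖ ^ m * q ^ (K + 1) =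
          (‖1 - lineL (y : ℂ)‖ ^ m * q ^ m) * (q ^ (i + 1) * q ^ 2) := by
        rw [hi]; ring
      rw [e]
      refine mul_le_mul ?_ ?_ (by positivity) (by positivity)
      · calc ‖1 - lineL (y : ℂ)‖ ^ m * q ^ m ≤ (Real.sqrt 6.15 ^ m * Real.sqrt W ^ m) * q ^ m :=
              mul_le_mul_of_nonneg_right hBm (by positivity)
          _ = (Real.sqrt 6.15 * Real.sqrt W * q) ^ m := by ring
          _ ≤ (0.99 : ℝ) ^ m := pow_le_pow_left₀ hprod0 hprod m
      · rw [hq2]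
        exact mul_le_mul_of_nonneg_right (pow_le_pow_left₀ hq0 hq11 _) (by positivity)
    calc ‖1 - lineL (y : ℂ)‖ ^ (-σ) * q ^ (K + 1)
        ≤ (2 * Real.sqrt 2 * ‖1 - lineL (y : ℂ)‖ ^ m) * q ^ (K + 1) :=
          mul_le_mul_of_nonneg_right hB1 (by positivity)
      _ = 2 * Real.sqrt 2 * ‖1 - lineL (y : ℂ)‖ ^ m * q ^ (K + 1) := by ring
      _ ≤ 2 * Real.sqrt 2 * ((0.99 : ℝ) ^ m * ((1.1 : ℝ) ^ (i + 1) * (1 / (2 * π * W)))) := hchain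
      _ = 2 * Real.sqrt 2 * (0.9 : ℝ) ^ m * (1.1 : ℝ) ^ (K - 1) / (2 * π) / W := by
          rw [hK1', pow_add, show (0.99 : ℝ) = 0.9 * 1.1 by norm_num, mul_pow]
          field_simp
          ring


/-! ## Step 5: Tonelli and the bound of Thm. 4.2 -/

/-- **The `u`–`y` double integral, swapped (Fubini–Tonelli for the non-negative majorant) and bounded**:
with the three numerical inputs on `L` — `W ≥ 0.1316` (i.e. `max 1/W ≤ 7.6 < 2π·1.21`), `∫ dy/W ≤ 15`
(i.e. `∫_L |dζ|/W ≤ 10.6`), `|1 − ζ|² ≤ 6.15 W` — one gets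
`|∫ e^{−4πu²}(−w)^{K+1}ℛ_K du/(2i sin πx)| ≤ Γ((K+1)/2) E(σ,K) · 15/(2π² a^{K+1})`.
[cite: AriasDeReyna2011, proof of Thm. 4.2, eq. (4.9) and the estimates following it] -/
theorem norm_integral_remIntegrand_le (ha : 0 < a) (hK1 : 1 ≤ K) (hσK : 0 ≤ σ ∨ (2 : ℝ) ≤ K + σ)
    (hm : ∀ y : ℝ, (0.1316 : ℝ) ≤ wL y) (hWi : Integrable fun y : ℝ ↦ (wL y)⁻¹)
    (hI : ∫ y : ℝ, (wL y)⁻¹ ≤ 15) (hA : ∀ y : ℝ, ‖1 - lineL y‖ ^ 2 ≤ 6.15 * wL y) :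
    ‖∫ u, remIntegrand σ a K u‖ ≤
      Real.Gamma (((K : ℝ) + 1) / 2) * eConst σ K * 15 / (2 * π ^ 2 * a ^ (K + 1)) := by
  have hKσ : 1 ≤ (K : ℝ) + σ := by
    rcases hσK with h | h
    · have : (1 : ℝ) ≤ K := by exact_mod_cast hK1
      linarith
    · linarith
  have hpos : ∀ y : ℝ, 0 < 1 + (fKer (lineL y)).re := one_add_re_fKer_pos (by norm_num) hm
  set Γ' : ℝ := Real.Gamma (((K : ℝ) + 1) / 2) with hΓ
  have hΓ0 : 0 < Γ' := Real.Gamma_pos_of_pos (by positivity)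
  set C₀ : ℝ := (Real.sqrt 2 / a) ^ (K + 1) / (2 * π ^ 2) with hC₀
  have hC₀0 : 0 ≤ C₀ := by positivity
  set g : ℝ → ℝ := fun u ↦ ∫ y, remMajorant σ K u y with hg
  have hg0 : ∀ u, 0 ≤ g u := fun u ↦ integral_nonneg (remMajorant_nonneg σ K u)
  set ψ : ℝ → ℝ := fun y ↦ ‖1 - lineL y‖ ^ (-σ) * Γ' /
    (‖lineL y‖ * Real.sqrt (4 * π * (1 + (fKer (lineL y)).re))) ^ (K + 1) with hψdef
  have hψ : ∀ y : ℝ, ∫ u, remMajorant σ K u y = ψ y := fun y ↦ integral_remMajorant (hpos y) σ K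
  set M : ℝ := Γ' * eConst σ K / Real.sqrt 2 ^ (K + 1) with hM
  have hE0 := eConst_nonneg σ K
  have hM0 : 0 ≤ M := by positivity
  have hs2 : 0 < Real.sqrt 2 ^ (K + 1) := by positivity
  have hψle : ∀ y : ℝ, ψ y ≤ M * (wL y)⁻¹ := by
    intro y
    have h := pointwise_le_eConst_div hK1 hσK (hm y) (hA y) (hpos y)
    have hW0 : 0 < wL y := by linarith [hm y]
    set X : ℝ := ‖1 - lineL (y : ℂ)‖ ^ (-σ) /
      (‖lineL (y : ℂ)‖ * Real.sqrt (4 * π * (1 + (fKer (lineL y)).re))) ^ (K + 1) with hX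
    have hψX : ψ y = Γ' * X := by
      simp only [hψdef, hX]; ring
    have hXle : X ≤ eConst σ K / wL y / Real.sqrt 2 ^ (K + 1) := by
      rw [le_div_iff₀ hs2, mul_comm]; exact h
    rw [hψX]
    calc Γ' * X ≤ Γ' * (eConst σ K / wL y / Real.sqrt 2 ^ (K + 1)) := mul_le_mul_of_nonneg_left hXle hΓ0.le
      _ = M * (wL y)⁻¹ := by rw [hM]; field_simp
  -- Tonelli on the non-negative majorant
  have hmeas : AEMeasurable (Function.uncurry fun u y : ℝ ↦ ENNReal.ofReal (remMajorant σ K u y))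
      (volume.prod volume) :=
    (ENNReal.measurable_ofReal.comp (continuous_remMajorant σ K).measurable).aemeasurable
  have hlin : ∫⁻ u, ENNReal.ofReal (g u) ≤ ENNReal.ofReal (M * 15) := by
    calc ∫⁻ u, ENNReal.ofReal (g u) = ∫⁻ u, ∫⁻ y, ENNReal.ofReal (remMajorant σ K u y) := by
          refine lintegral_congr fun u ↦ ?_
          exact ofReal_integral_eq_lintegral_ofReal (integrable_remMajorant_right σ hK1 hKσ u)
            (ae_of_all _ (remMajorant_nonneg σ K u))
      _ = ∫⁻ y, ∫⁻ u, ENNReal.ofReal (remMajorant σ K u y) := lintegral_lintegral_swap hmeas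
      _ = ∫⁻ y, ENNReal.ofReal (ψ y) := by
          refine lintegral_congr fun y ↦ ?_
          rw [← hψ y, ofReal_integral_eq_lintegral_ofReal (integrable_remMajorant_left (hpos y) σ K)
            (ae_of_all _ (fun u ↦ remMajorant_nonneg σ K u y))]
      _ ≤ ∫⁻ y, ENNReal.ofReal (M * (wL y)⁻¹) := lintegral_mono fun y ↦ ENNReal.ofReal_le_ofReal (hψle y)
      _ = ENNReal.ofReal (∫ y, M * (wL y)⁻¹) := by
          refine (ofReal_integral_eq_lintegral_ofReal (hWi.const_mul M) (ae_of_all _ fun y ↦ ?_)).symm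
          have hW0 : 0 < wL y := by linarith [hm y]
          exact mul_nonneg hM0 (inv_nonneg.2 hW0.le)
      _ ≤ ENNReal.ofReal (M * 15) := by
          refine ENNReal.ofReal_le_ofReal ?_
          rw [integral_const_mul]
          exact mul_le_mul_of_nonneg_left hI hM0
  -- the majorant `g` is integrable
  have hgm : AEStronglyMeasurable g volume :=
    ((continuous_remMajorant σ K).stronglyMeasurable.integral_prod_right' (ν := volume)).aestronglyMeasurable
  have hgi : Integrable g :=
    ⟨hgm, (hasFiniteIntegral_iff_ofReal (ae_of_all _ hg0)).2 (lt_of_le_of_lt hlin ENNReal.ofReal_lt_top)⟩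
  have h1 : ‖∫ u, remIntegrand σ a K u‖ ≤ ∫ u, C₀ * g u :=
    norm_integral_le_of_norm_le (hgi.const_mul C₀) (ae_of_all _ (norm_remIntegrand_le ha hK1 hKσ))
  rw [integral_const_mul] at h1
  have h2 : ∫ u, g u ≤ M * 15 := by
    rw [integral_eq_lintegral_of_nonneg_ae (ae_of_all _ hg0) hgm]
    exact ENNReal.toReal_le_of_le_ofReal (by positivity) hlin
  have ha' : 0 < a ^ (K + 1) := pow_pos ha _
  calc ‖∫ u, remIntegrand σ a K u‖ ≤ C₀ * ∫ u, g u := h1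
    _ ≤ C₀ * (M * 15) := mul_le_mul_of_nonneg_left h2 hC₀0
    _ = Γ' * eConst σ K * 15 / (2 * π ^ 2 * a ^ (K + 1)) := by
        rw [hC₀, hM, div_pow]
        field_simp

/-- `√2 < 1.4143` and `31 < π³`: the decimal facts behind `c₁ = 1/7` resp. `1/2`. [cite: AriasDeReyna2011, Thm. 4.2, eq. (4.8)] -/
lemma sqrt_two_lt_and_pi_cube : Real.sqrt 2 < 1.4143 ∧ (31.006 : ℝ) < π ^ 3 := by
  constructor
  · rw [Real.sqrt_lt' (by norm_num)]; norm_num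
  · have h := Real.pi_gt_d6
    have : (3.141592 : ℝ) ^ 3 < π ^ 3 := pow_lt_pow_left₀ h (by norm_num) (by norm_num)
    nlinarith

/-- **Arias de Reyna's Thm. 4.2 (the remainder bound), from the three numerical constants of the line `L`.**
For `a > 0`, `σ` real, `K ≥ 1` with `σ ≥ 0` or `K + σ ≥ 2`: the remainder term of Thm. 3.1 satisfies
`|c ∫ e^{−4πu²}(−w)^{K+1}ℛ_K du/(2i sin πx)| ≤ c₁(σ) Γ((K+1)/2) (1.1/a)^{K+1}`,
`c₁ = (1/7) 2^{3σ/2}` (`σ ≥ 0`), `c₁ = (1/2)(9/10)^{⌈−σ⌉}` (`σ < 0`), GIVEN `min_L W ≥ 0.1316`,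
`∫_ℝ dy/W ≤ 15`, `|1 − ζ|² ≤ 6.15 W` on `L` (the source's `7.489341`, `9.577048·√2`, `5.78453`).
[cite: AriasDeReyna2011, Thm. 4.2, eqs. (4.7)–(4.9)] -/
theorem norm_cConst_mul_integral_remIntegrand_le (ha : 0 < a) (hK1 : 1 ≤ K)
    (hσK : 0 ≤ σ ∨ (2 : ℝ) ≤ K + σ)
    (hm : ∀ y : ℝ, (0.1316 : ℝ) ≤ wL y) (hWi : Integrable fun y : ℝ ↦ (wL y)⁻¹)
    (hI : ∫ y : ℝ, (wL y)⁻¹ ≤ 15) (hA : ∀ y : ℝ, ‖1 - lineL y‖ ^ 2 ≤ 6.15 * wL y) :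
    ‖cConst * ∫ u, remIntegrand σ a K u‖ ≤
      (if 0 ≤ σ then 1 / 7 * (2 : ℝ) ^ (3 * σ / 2) else 1 / 2 * (9 / 10 : ℝ) ^ ⌈-σ⌉₊) *
        Real.Gamma (((K : ℝ) + 1) / 2) * (1.1 / a) ^ (K + 1) := by
  have h := norm_integral_remIntegrand_le ha hK1 hσK hm hWi hI hA
  obtain ⟨hs2, hπ3⟩ := sqrt_two_lt_and_pi_cube
  have hπ := Real.pi_pos
  obtain ⟨j, rfl⟩ : ∃ j : ℕ, K = j + 1 := ⟨K - 1, by omega⟩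
  set Γ' : ℝ := Real.Gamma ((((j + 1 : ℕ) : ℝ) + 1) / 2) with hΓ
  have hΓ0 : 0 < Γ' := Real.Gamma_pos_of_pos (by positivity)
  have ha' : 0 < a ^ (j + 2) := pow_pos ha _
  rw [norm_mul, norm_cConst]
  refine (mul_le_mul_of_nonneg_left h (Real.sqrt_nonneg 2)).trans ?_
  rw [show j + 1 + 1 = j + 2 by ring, div_pow (1.1 : ℝ) a (j + 2)]
  rcases le_or_gt 0 σ with hσ | hσ
  · have hE : eConst σ (j + 1) = (2 : ℝ) ^ (3 * σ / 2) * (1.1 : ℝ) ^ j / (2 * π) := by simp [eConst, hσ]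
    rw [if_pos hσ, hE]
    have key : Real.sqrt 2 * 15 / (4 * π ^ 3) ≤ 1.21 / 7 := by
      rw [div_le_div_iff₀ (by positivity) (by norm_num)]
      nlinarith
    have h2σ : 0 < (2 : ℝ) ^ (3 * σ / 2) := Real.rpow_pos_of_pos (by norm_num) _
    calc Real.sqrt 2 * (Γ' * ((2 : ℝ) ^ (3 * σ / 2) * (1.1 : ℝ) ^ j / (2 * π)) * 15 / (2 * π ^ 2 * a ^ (j + 2)))
        = Real.sqrt 2 * 15 / (4 * π ^ 3) * (Γ' * (2 : ℝ) ^ (3 * σ / 2) * (1.1 : ℝ) ^ j / a ^ (j + 2)) := by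
          field_simp; ring
      _ ≤ 1.21 / 7 * (Γ' * (2 : ℝ) ^ (3 * σ / 2) * (1.1 : ℝ) ^ j / a ^ (j + 2)) :=
          mul_le_mul_of_nonneg_right key (by positivity)
      _ = 1 / 7 * (2 : ℝ) ^ (3 * σ / 2) * Γ' * ((1.1 : ℝ) ^ (j + 2) / a ^ (j + 2)) := by
          rw [pow_add]; field_simp; ring
  · have hE : eConst σ (j + 1) = 2 * Real.sqrt 2 * (0.9 : ℝ) ^ ⌈-σ⌉₊ * (1.1 : ℝ) ^ j / (2 * π) := by
      simp [eConst, not_le.2 hσ]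
    rw [if_neg (not_le.2 hσ), hE]
    have key : (15 : ℝ) / π ^ 3 ≤ 1.21 / 2 := by
      rw [div_le_div_iff₀ (by positivity) (by norm_num)]
      nlinarith
    have hss : Real.sqrt 2 * Real.sqrt 2 = 2 := Real.mul_self_sqrt (by norm_num)
    calc Real.sqrt 2 * (Γ' * (2 * Real.sqrt 2 * (0.9 : ℝ) ^ ⌈-σ⌉₊ * (1.1 : ℝ) ^ j / (2 * π)) * 15 /
          (2 * π ^ 2 * a ^ (j + 2)))
        = (Real.sqrt 2 * Real.sqrt 2) * 15 / (2 * π ^ 3) *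
            (Γ' * (0.9 : ℝ) ^ ⌈-σ⌉₊ * (1.1 : ℝ) ^ j / a ^ (j + 2)) := by
          field_simp
      _ = 15 / π ^ 3 * (Γ' * (0.9 : ℝ) ^ ⌈-σ⌉₊ * (1.1 : ℝ) ^ j / a ^ (j + 2)) := by
          rw [hss]; field_simp
      _ ≤ 1.21 / 2 * (Γ' * (0.9 : ℝ) ^ ⌈-σ⌉₊ * (1.1 : ℝ) ^ j / a ^ (j + 2)) :=
          mul_le_mul_of_nonneg_right key (by positivity)
      _ = 1 / 2 * (9 / 10 : ℝ) ^ ⌈-σ⌉₊ * Γ' * ((1.1 : ℝ) ^ (j + 2) / a ^ (j + 2)) := by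
          rw [pow_add, show (0.9 : ℝ) = 9 / 10 by norm_num]; field_simp; ring


/-- `|U(a)| = 1`. [cite: AriasDeReyna2011, eq. (3.3)] -/
lemma norm_uPhase (a : ℝ) : ‖uPhase a‖ = 1 := by
  rw [uPhase, show -I * (((2 * π * a ^ 2 * Real.log a - π * a ^ 2 - π / 8 : ℝ)) : ℂ)
      = ((-(2 * π * a ^ 2 * Real.log a - π * a ^ 2 - π / 8) : ℝ) : ℂ) * I by push_cast; ring,
    Complex.norm_exp_ofReal_mul_I]

/-- **Thm. 3.1 + Thm. 4.2 on the saddle-point line (non-integer `a`)**, from the numerical constants of `L`: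
`|∫_{N↙N+1} x^{−s}e^{πix²}/(e^{πix}−e^{−πix}) dx − (−1)^{N+1} U a^{−σ} Σ_{k≤K} C_k/a^k| ≤ a^{−σ} c₁(σ) Γ((K+1)/2)/(a/1.1)^{K+1}`
for `a > 0` not an integer, `t = 2πa²`, `s = σ + it`, `K ≥ 1`, `σ ≥ 0` or `K + σ ≥ 2`.
[cite: AriasDeReyna2011, Thm. 3.1 (eq. (3.11)) and Thm. 4.2 (eqs. (4.7)–(4.8))] -/
theorem norm_rsLineIntegral_sub_main_le (ha : 0 < a) (hai : ∀ n : ℤ, (n : ℝ) ≠ a) (σ : ℝ) {K : ℕ}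
    (hK1 : 1 ≤ K) (hσK : 0 ≤ σ ∨ (2 : ℝ) ≤ K + σ)
    (hm : ∀ y : ℝ, (0.1316 : ℝ) ≤ wL y) (hWi : Integrable fun y : ℝ ↦ (wL y)⁻¹)
    (hI : ∫ y : ℝ, (wL y)⁻¹ ≤ 15) (hA : ∀ y : ℝ, ‖1 - lineL y‖ ^ 2 ≤ 6.15 * wL y) :
    ‖rsLineIntegral (⌊a⌋₊ + 1 / 2) ((σ : ℂ) + (2 * π * a ^ 2 : ℝ) * I) -
        (-1) ^ (⌊a⌋₊ + 1) * uPhase a * (a : ℂ) ^ (-(σ : ℂ)) *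
          ∑ k ∈ Finset.range (K + 1), coef σ a k / (a : ℂ) ^ k‖ ≤
      a ^ (-σ) * (if 0 ≤ σ then 1 / 7 * (2 : ℝ) ^ (3 * σ / 2) else 1 / 2 * (9 / 10 : ℝ) ^ ⌈-σ⌉₊) *
        Real.Gamma (((K : ℝ) + 1) / 2) / (a / 1.1) ^ (K + 1) := by
  have hKσ : 1 ≤ (K : ℝ) + σ := by
    rcases hσK with h | h
    · have : (1 : ℝ) ≤ K := by exact_mod_cast hK1
      linarith
    · linarith
  rw [rsLineIntegral_sub_main_eq ha hai σ hK1 hKσ]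
  have hrem := norm_cConst_mul_integral_remIntegrand_le ha hK1 hσK hm hWi hI hA (σ := σ)
  have hcpow : ‖(a : ℂ) ^ (-(σ : ℂ))‖ = a ^ (-σ) := by
    rw [Complex.norm_cpow_eq_rpow_re_of_pos ha]; simp
  have hsign : ‖((-1 : ℂ)) ^ (⌊a⌋₊ + 1)‖ = 1 := by rw [norm_pow, norm_neg, norm_one, one_pow]
  rw [norm_mul, norm_mul, norm_mul, hsign, norm_uPhase, hcpow, one_mul, one_mul,
    show ((-1 : ℂ)) ^ (⌊a⌋₊ + 1) * cConst * (∫ u : ℝ, (Real.exp (-4 * π * u ^ 2) : ℂ) *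
        ((-gW a u) ^ (K + 1) * lineRem σ (4 * π * u ^ 2) K (-gW a u)) / (2 * I * Complex.sin (π * line a u)))
      = ((-1 : ℂ)) ^ (⌊a⌋₊ + 1) * (cConst * ∫ u : ℝ, remIntegrand σ a K u) by rw [mul_assoc]; rfl,
    norm_mul, hsign, one_mul]
  refine (mul_le_mul_of_nonneg_left hrem (Real.rpow_nonneg ha.le _)).trans (le_of_eq ?_)
  set c₁ : ℝ := (if 0 ≤ σ then 1 / 7 * (2 : ℝ) ^ (3 * σ / 2) else 1 / 2 * (9 / 10 : ℝ) ^ ⌈-σ⌉₊)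
  have h11 : ((1.1 : ℝ) / a) ^ (K + 1) = 1 / (a / 1.1) ^ (K + 1) := by
    rw [← one_div_pow]; congr 1; field_simp
  rw [h11]
  ring

end AriasDeReyna

end Literature.NumberTheory.LFunctions
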